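import Literature.Probability.RandomPlanarGeometry.SLEImageBracketMartingale
import Literature.Probability.RandomPlanarGeometry.LoewnerImageChain
import Literature.Probability.Process.MartingaleClockTimeChange
import Literature.Probability.Process.BrownianConcatenation
import HarnessLib

/-!
# The image Brownian motion of SLE₆ under a `*`-hull (DDS time change of `W̃`, [LSW 2001] Thm. 2.2)

G. F. Lawler, O. Schramm, W. Werner, Acta Math. **187** (2001), Thm. 2.2 (locality of SLE₆) / *Conformal
restriction: the chordal case* (2003), §5: at `κ = 6` the image driving value `W̃_t = h_t(W_t)` of the
conformal image of the SLE₆ chain under `Φ_A` is a continuous local martingale with bracket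
`6 ∫₀ᵗ h_s'(W_s)² ds`, **hence a time change of `√6 ×` a Brownian motion: "`W̃_{τ(s)}/√6` is a standard
Brownian motion"**. Here, for a nonempty `*`-hull `A` and a localisation level `n`:

* `eventually_lt_imgLocTimeK` — the localising times `imgLocTimeK κ hA hne m` (`SLEImageLocalisation`)
  exhaust the alive times: if the closed hull at `t` misses `A` then `t < imgLocTimeK m` for all large `m`
  (the alive functional and `Φ'` are continuous and positive on `[0, t]`, the driver is bounded there);
* `exists_sle_image_brownian` — **the image Brownian motion at level `n`**: by the Dambis–Dubins–Schwarz
  time change of the bounded martingale `Mⁿ/√6` with its clock `imgClockK n`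
  (`hasMartingaleClock_imgMartK`, `HasMartingaleClock.timeChange`) concatenated with an independent
  Brownian motion (`isBrownianReal_concat`), there is on the product of two Wiener spaces a real Brownian
  motion `Bc` with continuous paths and measurable marginals such that, for every sample whose
  localising time `T₀` is positive, `√6 Bc s = Loewner.imageDriverC W A T₀ s` (`= W̃_{τ(s)}`,
  `LoewnerImageChain`) for all capacity times `s ≤ σ(T₀) = Loewner.imageClock W A T₀`.

This is the exact analogue, for a general `*`-hull, of `MoebiusPole.exists_imageBM`
(`SLESixMoebiusLocalityProofs`, the Möbius case of Lawler's Thm. 6.13).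

## References

* G. F. Lawler, O. Schramm, W. Werner, Acta Math. **187** (2001), Thm. 2.2. [LawlerSchrammWerner2001]
* [LSW] 2003, §5. [LawlerSchrammWerner2003Restriction]
* D. Revuz, M. Yor (1999), Ch. V Thm. (1.6)–(1.7). [RevuzYor1999]
-/

noncomputable section

open Set Filter Metric Function MeasureTheory ProbabilityTheory
open _root_.Complex _root_.Topology
open Literature.Probability.Process
open scoped NNReal

namespace Literature.Probability.RandomPlanarGeometry

open Loewner PathOps

/-! ### The localising times exhaust the alive times -/

section Exhaust

variable {κ : ℝ≥0} {A : Set ℂ}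

/-- Before a hitting time of a closed set by a continuous path: `t < hittingAfter u s 0 ω` as soon as the
path avoids `s` on `[0, t]`. [folklore] -/
theorem coe_lt_hittingAfter_of_forall_notMem {u : ℝ≥0 → (ℝ≥0 → ℝ) → ℝ} {s : Set ℝ} {ω : ℝ≥0 → ℝ} (hs : IsClosed s)
    (hc : Continuous fun t ↦ u t ω) {t : ℝ≥0} (h : ∀ j ≤ t, u j ω ∉ s) : (t : WithTop ℝ≥0) < hittingAfter u s 0 ω := by
  by_contra hnot
  obtain ⟨j, hj, hjs⟩ := (hittingAfter_zero_le_coe_iff hs hc).1 (not_lt.1 hnot)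
  exact h j hj hjs

/-- **The localising times exhaust the alive times**: if the closed hull at `t` misses `A`, then
`t < imgLocTimeK κ hA hne m ω` for all large `m`. [folklore] -/
theorem eventually_lt_imgLocTimeK (hA : IsStarHull A) (hne : A.Nonempty) {ω : ℝ≥0 → ℝ} {t : ℝ≥0}
    (ht : Disjoint (closedHull (drvK κ (brownianCPath ω)) t) A) :
    ∀ᶠ m in atTop, (t : WithTop ℝ≥0) < imgLocTimeK κ hA hne m ω := by
  set W := drvK κ (brownianCPath ω) with hW
  have hWc : Continuous W := continuous_drvK κ _
  have halive : ∀ s ≤ t, Disjoint (closedHull W s) A := fun s hs ↦ alive_mono hs ht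
  -- positive minimum of the alive functional on `[0, t]`
  have hRc : Continuous fun s ↦ RpK κ hA hne s ω := (continuous_RpK_DhatpK (κ := κ) (hA := hA) (hne := hne) 0 ω).1
  obtain ⟨s₁, hs₁, hmin₁⟩ := isCompact_Icc.exists_isMinOn (nonempty_Icc.2 (bot_le : (0 : ℝ≥0) ≤ t)) hRc.continuousOn
  set r₀ := RpK κ hA hne s₁ ω with hr₀
  have hr₀pos : 0 < r₀ := (RFnK_pos_iff (κ := κ) (hA := hA) (hne := hne) s₁ (brownianCPath ω)).2 (halive s₁ hs₁.2)
  have hRge : ∀ s ≤ t, r₀ ≤ RpK κ hA hne s ω := fun s hs ↦ hmin₁ ⟨bot_le, hs⟩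
  -- positive minimum of `Φ'` on `[0, t]`
  have hDc : ContinuousOn (fun s : ℝ≥0 ↦ starDeriv (slidHull W A s)) (Icc 0 t) := fun s hs ↦
    (continuousWithinAt_starDeriv_slidHull hWc hA hne (halive s hs.2)).mono fun v hv ↦ halive v hv.2
  obtain ⟨s₂, hs₂, hmin₂⟩ := isCompact_Icc.exists_isMinOn (nonempty_Icc.2 (bot_le : (0 : ℝ≥0) ≤ t)) hDc
  set d₀ := starDeriv (slidHull W A s₂) with hd₀
  have hd₀pos : 0 < d₀ := (starDeriv_pos_le_one _).1
  have hDge : ∀ s ≤ t, d₀ ≤ starDeriv (slidHull W A s) := fun s hs ↦ hmin₂ ⟨bot_le, hs⟩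
  -- bound of the driver on `[0, t]`
  obtain ⟨B, hB⟩ := isCompact_Icc.exists_bound_of_continuousOn (s := Icc (0 : ℝ≥0) t) hWc.continuousOn
  -- the thresholds
  have h1 : ∀ᶠ m : ℕ in atTop, locLevel m < r₀ := by
    have : Tendsto (fun m : ℕ ↦ locLevel m) atTop (𝓝 0) := by
      simp only [locLevel]
      exact tendsto_const_nhds.div_atTop (tendsto_natCast_atTop_atTop.atTop_add tendsto_const_nhds)
    exact this.eventually (gt_mem_nhds hr₀pos)
  have h2 : ∀ᶠ m : ℕ in atTop, locLevel m < d₀ := by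
    have : Tendsto (fun m : ℕ ↦ locLevel m) atTop (𝓝 0) := by
      simp only [locLevel]
      exact tendsto_const_nhds.div_atTop (tendsto_natCast_atTop_atTop.atTop_add tendsto_const_nhds)
    exact this.eventually (gt_mem_nhds hd₀pos)
  have h3 : ∀ᶠ m : ℕ in atTop, 1 < ((m : ℝ) + 1) * r₀ := by
    have : Tendsto (fun m : ℕ ↦ ((m : ℝ) + 1) * r₀) atTop atTop :=
      (tendsto_natCast_atTop_atTop.atTop_add tendsto_const_nhds).atTop_mul_const hr₀pos
    exact this.eventually (eventually_gt_atTop 1)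
  have h4 : ∀ᶠ m : ℕ in atTop, B < (m : ℝ) + 1 := (tendsto_natCast_atTop_atTop.atTop_add tendsto_const_nhds).eventually (eventually_gt_atTop B)
  have h5 : ∀ᶠ m : ℕ in atTop, (t : ℝ) < (m : ℝ) + 1 := (tendsto_natCast_atTop_atTop.atTop_add tendsto_const_nhds).eventually (eventually_gt_atTop _)
  filter_upwards [h1, h2, h3, h4, h5] with m hm1 hm2 hm3 hm4 hm5
  have hc0 := (locLevel_pos_le m).1
  -- (i) `t < hit{R ≤ c_m}`
  have hi : (t : WithTop ℝ≥0) < hittingAfter (RpK κ hA hne) (Iic (locLevel m)) 0 ω :=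
    coe_lt_hittingAfter_of_forall_notMem isClosed_Iic hRc fun j hj hjs ↦ (not_le.2 (hm1.trans_le (hRge j hj))) hjs
  -- (ii) `t < hit{D̂^{m+1} ≤ c_m}`
  have hii : (t : WithTop ℝ≥0) < hittingAfter (DhatpK κ hA hne (m + 1)) (Iic (locLevel m)) 0 ω := by
    refine coe_lt_hittingAfter_of_forall_notMem isClosed_Iic (continuous_RpK_DhatpK (κ := κ) (hA := hA) (hne := hne) (m + 1) ω).2
      fun j hj hjs ↦ ?_
    have hjs' : DhatpK κ hA hne (m + 1) j ω ≤ locLevel m := hjs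
    have hval : DhatpK κ hA hne (m + 1) j ω = min (starDeriv (slidHull W A j)) (((m + 1 : ℕ) : ℝ) * RpK κ hA hne j ω) := by
      rw [DhatpK, DhatFnK, (DFnK_eq (κ := κ) (A := A) j (brownianCPath ω)).1 (halive j hj)]; rfl
    rw [hval] at hjs'
    rcases min_le_iff.1 hjs' with h | h
    · exact absurd (hm2.trans_le (hDge j hj)) (not_lt.2 h)
    · have hR := hRge j hj
      have : 1 < ((m : ℝ) + 1) * RpK κ hA hne j ω := hm3.trans_le (mul_le_mul_of_nonneg_left hR (by positivity))
      have hle1 : locLevel m ≤ 1 := (locLevel_pos_le m).2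
      push_cast at h
      linarith
  -- (iii) `t < m + 1`
  have hiii : (t : WithTop ℝ≥0) < (((m : ℝ≥0) + 1 : ℝ≥0) : WithTop ℝ≥0) := by
    have : t < (m : ℝ≥0) + 1 := by exact_mod_cast hm5
    exact_mod_cast this
  -- (iv) `t < capTimeK m`
  have hiv : (t : WithTop ℝ≥0) < capTimeK κ m ω := by
    refine coe_lt_hittingAfter_of_forall_notMem isClosed_Ici hWc.abs fun j hj hjs ↦ ?_
    have hjs' : (m : ℝ) + 1 ≤ |W j| := hjs
    have := hB j ⟨bot_le, hj⟩
    rw [Real.norm_eq_abs] at this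
    linarith
  exact lt_min (lt_min (lt_min hi hii) hiii) hiv

end Exhaust

/-! ### The image Brownian motion -/

section ImageBM

variable {A : Set ℂ}

/-- The localising time read as a finite time `ρ = (n+1) ∧ imgLocTimeK n` coerces back to `imgLocTimeK n`.
[folklore] -/
theorem coe_untopA_min_imgLocTimeK {κ : ℝ≥0} {hA : IsStarHull A} {hne : A.Nonempty} (n : ℕ) (ω : ℝ≥0 → ℝ) :
    (((min ((((n : ℝ≥0) + 1 : ℝ≥0)) : WithTop ℝ≥0) (imgLocTimeK κ hA hne n ω)).untopA : ℝ≥0) : WithTop ℝ≥0) =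
      imgLocTimeK κ hA hne n ω := by
  rw [Literature.Analysis.FunctionSpaces.coe_untopA_min, min_eq_right (imgLocTimeK_le n ω)]

/-- **The image Brownian motion at level `n`** ([LSW 2001] Thm. 2.2: "`W̃_{τ(s)}/√6` is a standard Brownian
motion", localised). For a nonempty `*`-hull `A` and `n ∈ ℕ` there is a real Brownian motion `Bc` on the
product of two Wiener spaces, with continuous paths and measurable marginals, such that for every sample `z`
whose localising time `T₀ = imgLocTimeK 6 hA hne n z.1` is positive, `√6 · Bc s z` equals the
capacity-time image driving function `Loewner.imageDriverC W A T₀ s` (`W = drvK 6 (brownianCPath z.1)`,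
the SLE₆ driving function of the sample) for all capacity times `s ≤ σ(T₀) = Loewner.imageClock W A T₀`:
the DDS time change of the bounded martingale `Mⁿ/√6` by its clock (`hasMartingaleClock_imgMartK`,
`HasMartingaleClock.timeChange`), concatenated with an independent Brownian motion (`isBrownianReal_concat`),
read back through `tcProc_clock`, `imgMartK_eq_imageDriver` and `imgClockK_eq_imageClock`.
[cite: LawlerSchrammWerner2001, Thm. 2.2] -/
theorem exists_sle_image_brownian (hA : IsStarHull A) (hne : A.Nonempty) (n : ℕ) :
    ∃ Bc : ℝ≥0 → (ℝ≥0 → ℝ) × (ℝ≥0 → ℝ) → ℝ,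
      IsBrownianReal Bc (preWienerMeasure.prod preWienerMeasure) ∧
      (∀ s, Measurable (Bc s)) ∧ (∀ z, Continuous (Bc · z)) ∧
      ∀ (z : (ℝ≥0 → ℝ) × (ℝ≥0 → ℝ)) (T₀ : ℝ≥0), imgLocTimeK 6 hA hne n z.1 = T₀ → 0 < T₀ →
        ∀ s : ℝ≥0, (s : ℝ) ≤ imageClock (drvK 6 (brownianCPath z.1)) A T₀ →
          Real.sqrt 6 * Bc s z = imageDriverC (drvK 6 (brownianCPath z.1)) A T₀ s := by
  haveI := isProbabilityMeasure_preWienerMeasure'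
  have h6 : (0 : ℝ) < Real.sqrt 6 := Real.sqrt_pos.2 (by norm_num)
  set P : Measure (ℝ≥0 → ℝ) := preWienerMeasure with hPdef
  set τ := imgLocTimeK 6 hA hne n with hτdef
  set Tn : ℝ≥0 := (n : ℝ≥0) + 1 with hTn
  set ρ : (ℝ≥0 → ℝ) → ℝ≥0 := fun ω ↦ (min (Tn : WithTop ℝ≥0) (τ ω)).untopA with hρdef
  have hρcoe : ∀ ω, (ρ ω : WithTop ℝ≥0) = τ ω := fun ω ↦ coe_untopA_min_imgLocTimeK (κ := 6) (hA := hA) (hne := hne) n ω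
  set Y : ℝ≥0 → (ℝ≥0 → ℝ) → ℝ := fun t ω ↦ (Real.sqrt 6)⁻¹ * imgMartK 6 hA hne n t ω with hYdef
  set c : ℝ≥0 → (ℝ≥0 → ℝ) → ℝ := imgClockK 6 hA hne n with hcdef
  set 𝓕 : Filtration ℝ≥0 (inferInstance : MeasurableSpace (ℝ≥0 → ℝ)) := brownianFiltration with h𝓕
  -- Step 1: the martingale clock and the time change
  obtain ⟨N, hclock⟩ := hasMartingaleClock_imgMartK hA hne n
  have hYad : StronglyAdapted 𝓕 Y := fun t ↦ ((stronglyAdapted_imgMartK (κ := 6) (hA := hA) (hne := hne) n) t).const_mul _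
  have hYc : ∀ ω, Continuous (Y · ω) := fun ω ↦ continuous_const.mul (continuous_imgMartK n ω)
  have hcad : Adapted 𝓕 c := adapted_imgClockK n
  have hρst : IsStoppingTime 𝓕 fun ω ↦ (ρ ω : WithTop ℝ≥0) := by
    have heq : (fun ω ↦ (ρ ω : WithTop ℝ≥0)) = τ := funext hρcoe
    rw [heq]; exact isStoppingTime_imgLocTimeK n
  have hρT : ∀ ω, ρ ω ≤ Tn := fun ω ↦ Literature.Analysis.FunctionSpaces.untopA_min_le _ _
  have hfrozen : ∀ t ω, c t ω = c (min t (ρ ω)) ω := by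
    intro t ω
    rw [hcdef, imgClockK_eq_timeIntegral_min, imgClockK_eq_timeIntegral_min]
    congr 1
    rw [← hτdef, WithTop.coe_min, hρcoe, min_assoc, min_self]
  have htc := hclock.timeChange hYad hYc hcad hρst hρT hfrozen
  have hcc := hclock.continuous_clock
  have hc0 := hclock.clock_zero
  have hmono := hclock.monotone_clock
  have hnn : ∀ t ω, 0 ≤ c t ω := fun t ω ↦ hclock.clock_nonneg ω t
  have hstrict : ∀ ω, StrictMonoOn (fun t ↦ c t ω) (Icc 0 (ρ ω)) := fun ω ↦
    strictMonoOn_imgClockK (κ := 6) (hA := hA) (hne := hne) (n := n) (by rw [hρcoe])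
  set 𝒢 := tcFiltration hcad hcc hρst with h𝒢def
  -- Step 2: concatenation with an independent Brownian motion
  set σc : (ℝ≥0 → ℝ) → ℝ≥0 := fun ω ↦ (totalClock c ρ ω).toNNReal with hσcdef
  have hσc0 : ∀ ω, 0 ≤ totalClock c ρ ω := fun ω ↦ hclock.clock_nonneg ω _
  have hσccoe : ∀ ω, ((σc ω : ℝ≥0) : ℝ) = totalClock c ρ ω := fun ω ↦ Real.coe_toNNReal _ (hσc0 ω)
  have hmin_eq : ∀ (s : ℝ≥0) ω, min (s : ℝ) (totalClock c ρ ω) = ((min s (σc ω) : ℝ≥0) : ℝ) := by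
    intro s ω; rw [NNReal.coe_min, hσccoe]
  have htc' : HasMartingaleClock (tcProc Y c ρ) (fun s ω ↦ ((min s (σc ω) : ℝ≥0) : ℝ)) 𝒢 P N := by
    have heq : (fun (s : ℝ≥0) ω ↦ ((min s (σc ω) : ℝ≥0) : ℝ)) = fun (s : ℝ≥0) ω ↦ min (s : ℝ) (totalClock c ρ ω) := by
      funext s ω; exact (hmin_eq s ω).symm
    rw [heq]; exact htc
  have hYprog : IsStronglyProgressive 𝓕 Y := hYad.isStronglyProgressive_of_continuous hYc
  have hcontY : ∀ ω, Continuous fun s ↦ tcProc Y c ρ s ω := continuous_tcProc hYc hc0 hcc hmono hstrict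
  have hYad' : ∀ s, StronglyMeasurable[𝒢 s] (tcProc Y c ρ s) := fun s ↦
    (measurable_tcProc hcad hcc hρst hYprog s).stronglyMeasurable
  have hσcm : Measurable σc := (measurable_totalClock hcad hcc hρst).real_toNNReal
  have hcad' : ∀ s : ℝ≥0, Measurable[𝒢 s] fun ω ↦ min s (σc ω) := by
    intro s
    have h1 := (measurable_min_totalClock hcad hcc hρst hc0 hmono hfrozen s).real_toNNReal
    have heq : (fun ω ↦ (min (s : ℝ) (totalClock c ρ ω)).toNNReal) = fun ω ↦ min s (σc ω) := by
      funext ω; rw [hmin_eq, Real.toNNReal_coe]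
    rwa [heq] at h1
  have hY0 : ∀ ω, tcProc Y c ρ 0 ω = 0 := fun ω ↦ by
    rw [tcProc_zero hc0]
    show (Real.sqrt 6)⁻¹ * imgMartK 6 hA hne n 0 ω = 0
    rw [imgMartK_zero, mul_zero]
  set M : ℝ≥0 → (ℝ≥0 → ℝ) × (ℝ≥0 → ℝ) → ℝ := fun s z ↦ tcProc Y c ρ s z.1 +
    (Process.brownian s z.2 - Process.brownian (min s (σc z.1)) z.2) with hMdef
  have hBM : IsBrownianReal M (P.prod preWienerMeasure) := isBrownianReal_concat htc' hcontY hYad' hσcm hcad' hY0 rfl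
  have hMc : ∀ z, Continuous (M · z) := continuous_concat rfl hcontY
  have hMm : ∀ t, Measurable (M t) := measurable_concat hMdef hYad' hcad'
  refine ⟨M, hBM, hMm, hMc, ?_⟩
  -- Step 3: agreement with the image driver in capacity time
  rintro ⟨ω, ω'⟩ T₀ hT₀ hT0 s hs
  simp only at hT₀ hs ⊢
  set W := drvK 6 (brownianCPath ω) with hWdef
  have hWc : Continuous W := continuous_drvK 6 _
  have hτT : τ ω = T₀ := hT₀
  have h0 : (0 : WithTop ℝ≥0) < τ ω := by rw [hτT]; exact_mod_cast hT0
  have hρω : ρ ω = T₀ := WithTop.coe_injective ((hρcoe ω).trans hτT)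
  have hleT : ((T₀ : ℝ≥0) : WithTop ℝ≥0) ≤ τ ω := by rw [hτT]
  have hβ : Disjoint (closedHull W T₀) A := (imgDrvP_eq_of_le (κ := 6) (hA := hA) (hne := hne) (n := n) hleT h0).1
  -- the capacity time `s` is `σ(t)` for `t = τ_clock(s) ∈ [0, T₀]`
  have hS0 : 0 ≤ imageClock W A T₀ := (imageClock_mem hWc hA hne hβ ⟨T₀.coe_nonneg, le_rfl⟩).1
  have hsI : (s : ℝ) ∈ Icc (0 : ℝ) (imageClock W A T₀) := ⟨s.coe_nonneg, hs⟩
  obtain ⟨htI, hσt⟩ := imageClockInv_spec hWc hA hne hβ hsI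
  set t : ℝ := imageClockInv W A T₀ s with htdef
  set t' : ℝ≥0 := t.toNNReal with ht'def
  have ht'coe : (t' : ℝ) = t := Real.coe_toNNReal _ htI.1
  have ht'le : t' ≤ T₀ := by
    have := Real.toNNReal_le_toNNReal htI.2; rwa [Real.toNNReal_coe] at this
  have ht'ρ : t' ≤ ρ ω := hρω ▸ ht'le
  have ht'τ : ((t' : ℝ≥0) : WithTop ℝ≥0) ≤ τ ω := by rw [← hρcoe]; exact WithTop.coe_le_coe.2 ht'ρ
  -- the clock and the process at `t'`
  have hct' : c t' ω = s := by
    rw [hcdef, imgClockK_eq_imageClock ht'τ h0, ← hWdef, ht'coe, hσt]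
  have hMt' : imgMartK 6 hA hne n t' ω = imageDriver W A t' := imgMartK_eq_imageDriver ht'τ h0
  -- `M s = Ỹ_s = Y_{t'}`
  have hle : s ≤ σc ω := by
    rw [← NNReal.coe_le_coe, hσccoe, totalClock, ← hct']
    exact hmono ω ht'ρ
  have hMs : M s (ω, ω') = Y t' ω := by
    have hcat : M s (ω, ω') = tcProc Y c ρ s ω := @concat_eq_of_le _ (tcProc Y c ρ) σc M hMdef s (ω, ω') hle
    rw [hcat]
    have h1 := tcProc_clock (Y := Y) hcc hstrict hnn ht'ρ
    change tcProc Y c ρ (c t' ω).toNNReal ω = Y t' ω at h1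
    rw [hct', Real.toNNReal_coe] at h1
    exact h1
  rw [hMs]
  show Real.sqrt 6 * ((Real.sqrt 6)⁻¹ * imgMartK 6 hA hne n t' ω) = imageDriverC W A T₀ s
  rw [← mul_assoc, mul_inv_cancel₀ h6.ne', one_mul, hMt', imageDriverC, min_eq_left hs]

end ImageBM

end Literature.Probability.RandomPlanarGeometry

end
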